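import Mathlib
import Summits.NavierStokesRegularity.NavierStokesRegularity.Theorems.LandauTailLandauTailBlowupDefectFloor
import Summits.NavierStokesRegularity.NavierStokesRegularity.Theorems.LandauTailLandauTailBlowupGradientDyadic

/-!
# Crux `LandauTail.LandauTailBlowup` (stmt-NavierStokesRegularity-1944), line `registered`, cycle c6:
  stub `landauTail_relative_defect_floor` — the dimensionless defect floor

Helper file on the proof path of the crux item `stmt-NavierStokesRegularity-1944`
(`Summit.NavierStokesRegularity.NavierStokesRegularity.Theses.LandauTail.LandauTailBlowup`), lead c6: the
registered support stub `landauTail_relative_defect_floor` (D2), the dimensionless form of the quantitative flux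
theorem. For a nonzero steady `(−1)`-homogeneous profile `(U, P)` smooth off the origin there is `κ = κ(U) > 0`
such that for every Landau-tailed classical unit-viscosity `(u, p)` on `ℝ³ × (−1, 0)`, every core ratio
`ρ ∈ (0, 1]` and every window `−1 ≤ s₁ < s₂ ≤ 0`,

  `liminf_{r → 0⁺} ∫_{s₁}^{s₂} ∫_{B_ρ} |nsRescale r u − U|² ≥ κ ∫_{s₁}^{s₂} ∫_{B_ρ} |U|²`:

in EVERY parabolic core tube the `L²`-deviation of the blow-up rescalings from the Landau flow is at least the fixed
fraction `κ` of Landau's own `L²` mass there — although the rescalings converge to `U` pointwise. Proof: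
`landauTail_defect_floor` gives the floor `c ρ (s₂ − s₁)`, and by homogeneity
`∫_{s₁}^{s₂}∫_{B_ρ}|U|² = (s₂ − s₁) ρ ∫_{B₁}|U|²` (`landauTail_lintegral_profile_sq_ball`), with `∫_{B₁}|U|² < ∞`
(the profile is enveloped by `K/|x|`); `κ = c / (∫_{B₁}|U|² + 1)`.

References: Landau 1944; Lemarié-Rieusset 2016 (10.48).
-/

set_option linter.dupNamespace false

noncomputable section

open Filter Set Topology MeasureTheory Metric Function
open scoped ENNReal NNReal
open Literature.Analysis.FluidPDE

namespace Summit.NavierStokesRegularity.NavierStokesRegularity.Theorems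

/-- **Scaling of the `L²` mass of a `(−1)`-homogeneous field on balls**: `∫_{B_ρ} |U|² = ρ ∫_{B₁} |U|²` for
`ρ > 0` (substitute `x = ρ y`, `|U(ρy)|² = ρ⁻² |U(y)|²`, `dx = ρ³ dy`). [folklore] -/
theorem landauTail_lintegral_profile_sq_ball {U : EuclideanSpace ℝ (Fin 3) → EuclideanSpace ℝ (Fin 3)}
    (hhom : ∀ c : ℝ, 0 < c → ∀ x, U (c • x) = c⁻¹ • U x) {ρ : ℝ} (hρ : 0 < ρ) :
    ∫⁻ x in ball (0 : EuclideanSpace ℝ (Fin 3)) ρ, ‖U x‖ₑ ^ 2 =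
      ENNReal.ofReal ρ * ∫⁻ x in ball (0 : EuclideanSpace ℝ (Fin 3)) 1, ‖U x‖ₑ ^ 2 := by
  have h := landauTail_gradDyadic_setLIntegral_ball_smul (fun y => ‖U y‖ₑ ^ 2) hρ 0 1
  rw [smul_zero, mul_one] at h
  rw [h]
  have hpt : ∀ x : EuclideanSpace ℝ (Fin 3), ‖U (ρ • x)‖ₑ ^ 2 = ENNReal.ofReal (ρ⁻¹ ^ 2) * ‖U x‖ₑ ^ 2 := by
    intro x
    rw [hhom ρ hρ x, enorm_smul, mul_pow, Real.enorm_eq_ofReal (inv_nonneg.2 hρ.le),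
      ENNReal.ofReal_pow (inv_nonneg.2 hρ.le)]
  simp_rw [hpt]
  rw [lintegral_const_mul' _ _ ENNReal.ofReal_ne_top, ← mul_assoc, ← ENNReal.ofReal_mul (by positivity)]
  congr 2
  field_simp

/-- **The relative defect floor — dimensionless form of the quantitative flux theorem** (registered support stub
D2 of crux stmt-NavierStokesRegularity-1944, lead c6): there is `κ = κ(U) > 0` such that for every
Landau-tailed classical unit-viscosity `(u, p)` on `ℝ³ × (−1,0)`, all `ρ ∈ (0,1]` and `−1 ≤ s₁ < s₂ ≤ 0`,
`κ ∫_{s₁}^{s₂}∫_{B_ρ}|U|² ≤ liminf_{r→0⁺} ∫_{s₁}^{s₂}∫_{B_ρ}|nsRescale r u − U|²`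
(Landau 1944; Lemarié-Rieusset 2016 (10.48)). -/
theorem landauTail_relative_defect_floor : ∀ (U : EuclideanSpace ℝ (Fin 3) → EuclideanSpace ℝ (Fin 3)) (P : EuclideanSpace ℝ (Fin 3) → ℝ), (ContDiffOn ℝ (⊤ : ℕ∞) U {0}ᶜ ∧ ContDiffOn ℝ (⊤ : ℕ∞) P {0}ᶜ ∧ (∀ x : EuclideanSpace ℝ (Fin 3), x ≠ 0 → Literature.Analysis.FluidPDE.convect U U x + gradient P x = (1 : ℝ) • Laplacian.laplacian U x) ∧ (∀ x : EuclideanSpace ℝ (Fin 3), x ≠ 0 → Literature.Analysis.FluidPDE.VectorCalculus.divergence U x = 0) ∧ (∀ c : ℝ, 0 < c → ∀ x : EuclideanSpace ℝ (Fin 3), U (c • x) = c⁻¹ • U x) ∧ (∃ x : EuclideanSpace ℝ (Fin 3), U x ≠ 0)) → ∃ κ : ℝ, 0 < κ ∧ ∀ (u : ℝ → EuclideanSpace ℝ (Fin 3) → EuclideanSpace ℝ (Fin 3)) (p : ℝ → EuclideanSpace ℝ (Fin 3) → ℝ), Literature.Analysis.FluidPDE.IsClassicalNSSolutionOn (Set.Ioo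 (-1) 0) 1 0 u p → (∀ y : EuclideanSpace ℝ (Fin 3), y ≠ 0 → Filter.Tendsto (fun t : ℝ => Real.sqrt (0 - t) • u t (Real.sqrt (0 - t) • y)) (nhdsWithin 0 (Set.Iio 0)) (nhds (U y))) → ∀ ρ : ℝ, 0 < ρ → ρ ≤ 1 → ∀ s₁ s₂ : ℝ, -1 ≤ s₁ → s₁ < s₂ → s₂ ≤ 0 → ENNReal.ofReal κ * (∫⁻ z in Set.Ioo s₁ s₂ ×ˢ Metric.ball (0 : EuclideanSpace ℝ (Fin 3)) ρ, ‖U z.2‖ₑ ^ 2) ≤ Filter.liminf (fun r : ℝ => ∫⁻ z in Set.Ioo s₁ s₂ ×ˢ Metric.ball (0 : EuclideanSpace ℝ (Fin 3)) ρ, ‖Literature.Analysis.FluidPDE.nsRescale r u z.1 z.2 - U z.2‖ₑ ^ 2) (nhdsWithin 0 (Set.Ioi 0)) := by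
  intro U P hprof
  obtain ⟨c, hc, hA7⟩ := landauTail_defect_floor U P hprof
  obtain ⟨hUs, -, -, -, hhom, -⟩ := hprof
  have hUc : ContinuousOn U {0}ᶜ := hUs.continuousOn
  have hUm : AEStronglyMeasurable U volume := (landauTail_profile_measurable hUc).aestronglyMeasurable
  -- Landau's `L²` mass on the unit ball
  set I₁ : ℝ≥0∞ := ∫⁻ x in ball (0 : EuclideanSpace ℝ (Fin 3)) 1, ‖U x‖ₑ ^ 2 with hI₁
  have hI₁top : I₁ ≠ ⊤ := by
    have h := landauTail_lintegral_profile_rpow_lt_top hUc hhom two_pos (by norm_num : (2 : ℝ) < 3)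
    have e : I₁ = ∫⁻ x in ball (0 : EuclideanSpace ℝ (Fin 3)) 1, ‖U x‖ₑ ^ (2 : ℝ) := by
      refine lintegral_congr fun x => ?_
      rw [← ENNReal.rpow_natCast]
      norm_num
    rw [e]
    exact h.ne
  refine ⟨c / (I₁.toReal + 1), by positivity, ?_⟩
  intro u p hcl htail ρ hρ hρ1 s₁ s₂ hs₁ hs₁₂ hs₂
  -- the `L²` mass of `U` on the core tube
  have hprod : ∫⁻ z in Ioo s₁ s₂ ×ˢ ball (0 : EuclideanSpace ℝ (Fin 3)) ρ, ‖U z.2‖ₑ ^ 2 =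
      ENNReal.ofReal (s₂ - s₁) * (ENNReal.ofReal ρ * I₁) := by
    rw [← landauTail_lintegral_profile_sq_ball hhom hρ, Measure.volume_eq_prod, ← Measure.prod_restrict]
    have e : (fun z : ℝ × EuclideanSpace ℝ (Fin 3) => ‖U z.2‖ₑ ^ 2) =
        fun z => (fun _ : ℝ => (1 : ℝ≥0∞)) z.1 * (fun x : EuclideanSpace ℝ (Fin 3) => ‖U x‖ₑ ^ 2) z.2 := by
      funext z; simp only [one_mul]
    rw [e, lintegral_prod_mul aemeasurable_const (hUm.restrict.enorm.pow_const _), lintegral_const,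
      Measure.restrict_apply_univ, one_mul, Real.volume_Ioo]
  rw [hprod]
  refine le_trans ?_ (hA7 u p hcl htail ρ hρ hρ1 s₁ s₂ hs₁ hs₁₂ hs₂)
  -- `κ (s₂ − s₁) ρ I₁ ≤ c ρ (s₂ − s₁)` since `κ (I₁ + 1) = c`
  have hI₁le : I₁ ≤ ENNReal.ofReal (I₁.toReal + 1) := by
    conv_lhs => rw [← ENNReal.ofReal_toReal hI₁top]
    exact ENNReal.ofReal_le_ofReal (by linarith)
  have hL : 0 ≤ s₂ - s₁ := by linarith
  calc ENNReal.ofReal (c / (I₁.toReal + 1)) * (ENNReal.ofReal (s₂ - s₁) * (ENNReal.ofReal ρ * I₁))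
      ≤ ENNReal.ofReal (c / (I₁.toReal + 1)) *
          (ENNReal.ofReal (s₂ - s₁) * (ENNReal.ofReal ρ * ENNReal.ofReal (I₁.toReal + 1))) := by gcongr
    _ = ENNReal.ofReal (c * ρ * (s₂ - s₁)) := by
        rw [← ENNReal.ofReal_mul hρ.le, ← ENNReal.ofReal_mul hL, ← ENNReal.ofReal_mul (by positivity)]
        congr 1
        field_simp

end Summit.NavierStokesRegularity.NavierStokesRegularity.Theorems

end
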